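import Mathlib.AlgebraicTopology.FundamentalGroupoid.FundamentalGroup
import Mathlib.Geometry.Manifold.Diffeomorph
import Literature.Topology.FourManifolds.LickorishTwistSurgery
import Literature.Topology.FourManifolds.Cobordism
import Literature.Topology.FourManifolds.GenusOneHandlebodyBoundary
import Literature.Topology.FourManifolds.GroupTrisections
import Literature.AlgebraicTopology.FundamentalGroup.CircleAndTorus
import Literature.AlgebraicTopology.FundamentalGroup.MapOfEqRange
import HarnessLib

/-!
# Stub `stub_kernelPairTransport` of line `jaco-splitting-homomorphism` for crux `CongruenceShadows.WaldhausenPairs`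
(item stmt-SmoothPoincare4-14592, route route-SmoothPoincare4-CongruenceShadows)

**Kernel pairs are natural under diffeomorphisms of Heegaard triples** (Hempel, *3-Manifolds*
(1976), the step "a homeomorphism of Heegaard splittings gives equivalent splitting homomorphisms"
in the proof of Thm. 14.6; the easy direction `f ↦ f_*` of Dehn–Nielsen–Baer plus change of base
point, Hatcher, *Algebraic Topology* (2002), Prop. 1.5 and Prop. 1.18).

Let `Y = H₁ ∪_f H₂` and `Y' = H₁' ∪_{f'} H₂'` be explicit boundary gluings
(`IsBoundaryGluingWith bᵣ … (𝓡 3) j₁ j₂`) and let `(Φ, ψ₁, ψ₂)` be a diffeomorphism of triples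
(`Φ ∘ j₁ = j₁' ∘ ψ₁`, `Φ ∘ j₂ = j₂' ∘ ψ₂`).  Given markings `μ : S_g ≅ π₁(∂H₁, x)`,
`μ' : S_g ≅ π₁(∂H₁', x')` (with `∂H₁'` connected), there is ONE automorphism `α` of `S_g` carrying the
kernel pair `(ker π₁(incl₁), ker π₁(incl₂ ∘ f))` read through `μ` onto the kernel pair
`(ker π₁(incl₁'), ker π₁(incl₂' ∘ f'))` read through `μ'`:

1. `ψ₁` preserves boundaries (`Diffeomorph.boundaryHomeomorph`), so it restricts to a homeomorphism
   `σ : ∂H₁ ≃ₜ ∂H₁'` with `incl₁' ∘ σ = ψ₁ ∘ incl₁`;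
2. the seam relations of the two gluings and the two intertwining identities give the second square
   `incl₂' ∘ f' ∘ σ = ψ₂ ∘ incl₂ ∘ f`;
3. along a commuting square whose horizontal maps are homeomorphisms, `σ_*` carries `ker π₁(incl₁)`
   onto `ker π₁(incl₁')` (at the base point `σ x`), and likewise for the second kernel (functoriality
   of `π₁`, Hatcher §1.1 p. 34 and Prop. 1.18);
4. a path `ζ` from `σ x` to `x'` in the path-connected surface `∂H₁'` changes the base point; the
   change-of-base-point isomorphism is natural (Hatcher Prop. 1.5), so it preserves both kernels;
5. `α := μ ≫ σ_* ≫ T_ζ ≫ μ'⁻¹`.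

This is the registered stub `stub_kernelPairTransport` (S3) of the checked skeleton of the line; its
consumer is `heegaardPairOrbit_of_line` there.  Everything is proved from tree / Mathlib declarations;
no definitions, no named facts, no handlebody hypothesis.
-/

-- the prescribed namespace `Summit.<P>.<Sub>.…` duplicates `SmoothPoincare4` (P = Sub)
set_option linter.dupNamespace false
noncomputable section
open scoped Manifold ContDiff Topology
open Set Function Subgroup Literature.Topology.FourManifolds
open Literature.AlgebraicTopology.FundamentalGroup (fundamentalGroupEquivOfHomeomorph
  fundamentalGroupEquivOfHomeomorph_apply mapOfEq_rfl_apply)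

namespace Summit.SmoothPoincare4.SmoothPoincare4.Theorems.WaldhausenPairs.JacoSplittingHomomorphism

section Helpers

/-! ### Group-theoretic bookkeeping -/

/-- **Kernels along a commuting square of groups.**  If `ψ ∘ θ = θ' ∘ φ` with `θ` an isomorphism
and `θ'` injective (an isomorphism), then `θ` maps `ker φ` onto `ker ψ`. [folklore] -/
private theorem map_ker_eq_ker_of_sq {A B C D : Type*} [Group A] [Group B] [Group C] [Group D]
    (φ : A →* C) (ψ : B →* D) (θ : A ≃* B) (θ' : C ≃* D) (h : ∀ a, ψ (θ a) = θ' (φ a)) :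
    (φ.ker).map θ.toMonoidHom = ψ.ker := by
  ext b
  simp only [Subgroup.mem_map, MonoidHom.mem_ker, MulEquiv.coe_toMonoidHom]
  constructor
  · rintro ⟨a, ha, rfl⟩
    rw [h, ha, map_one]
  · intro hb
    refine ⟨θ.symm b, θ'.injective ?_, θ.apply_symm_apply b⟩
    rw [← h, θ.apply_symm_apply, hb, map_one]

/-- **Composite transport.**  Mapping a subgroup along `θ₁ ≫ θ₂` is mapping along `θ₁`, then along
`θ₂`. [folklore] -/
private theorem map_trans_eq_map_map {A B C : Type*} [Group A] [Group B] [Group C] (θ₁ : A ≃* B)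
    (θ₂ : B ≃* C) (K : Subgroup A) :
    K.map (θ₁.trans θ₂).toMonoidHom = (K.map θ₁.toMonoidHom).map θ₂.toMonoidHom := by
  ext c
  simp only [Subgroup.mem_map, MulEquiv.coe_toMonoidHom, MulEquiv.trans_apply]
  constructor
  · rintro ⟨a, ha, rfl⟩
    exact ⟨θ₁ a, ⟨a, ha, rfl⟩, rfl⟩
  · rintro ⟨b, ⟨a, ha, rfl⟩, rfl⟩
    exact ⟨a, ha, rfl⟩

/-- **Reading a subgroup through two markings.**  For markings `μ : S ≅ B`, `μ' : S ≅ B'` and an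
isomorphism `Θ : B ≅ B'`, the automorphism `α = μ ≫ Θ ≫ μ'⁻¹` of `S` carries `μ⁻¹(K)` onto
`μ'⁻¹(Θ(K))`. [folklore] -/
private theorem map_comap_markings {S B B' : Type*} [Group S] [Group B] [Group B'] (μ : S ≃* B)
    (μ' : S ≃* B') (Θ : B ≃* B') (K : Subgroup B) :
    (K.comap μ.toMonoidHom).map (μ.trans (Θ.trans μ'.symm)).toMonoidHom =
      (K.map Θ.toMonoidHom).comap μ'.toMonoidHom := by
  ext s
  simp only [Subgroup.mem_map, Subgroup.mem_comap, MulEquiv.coe_toMonoidHom,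
    MulEquiv.trans_apply]
  constructor
  · rintro ⟨t, ht, rfl⟩
    exact ⟨μ t, ht, (μ'.apply_symm_apply _).symm⟩
  · rintro ⟨b, hb, hbs⟩
    refine ⟨μ.symm b, by rwa [μ.apply_symm_apply], ?_⟩
    rw [μ.apply_symm_apply, hbs, μ'.symm_apply_apply]

/-! ### Functoriality of `π₁` -/

variable {F F' Z Z' W : Type*} [TopologicalSpace F] [TopologicalSpace F'] [TopologicalSpace Z]
  [TopologicalSpace Z'] [TopologicalSpace W]

/-- **Pointwise-equal composites induce the same homomorphism on `π₁`**: if `q ∘ p = q' ∘ p'`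
pointwise then `q_* ∘ p_* = q'_* ∘ p'_*` on `π₁(F, x)` (functoriality of induced homomorphisms,
Hatcher §1.1 p. 34; evaluation on loops). [folklore] -/
private theorem map_mapOfEq_congr (p : C(F, Z)) (q : C(Z, W)) (p' : C(F, Z')) (q' : C(Z', W))
    {x : F} {z : Z} (hp : p x = z) (hq' : q' (p' x) = q z) (h : ∀ y, q (p y) = q' (p' y))
    (a : FundamentalGroup F x) :
    FundamentalGroup.map q z (FundamentalGroup.mapOfEq p hp a) =
      FundamentalGroup.mapOfEq q' hq' (FundamentalGroup.map p' x a) := by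
  subst hp
  rw [← mapOfEq_rfl_apply, ← mapOfEq_rfl_apply p']
  induction a using Quotient.ind with
  | _ γ =>
    rw [FundamentalGroup.mapOfEq_apply, FundamentalGroup.mapOfEq_apply,
      FundamentalGroup.mapOfEq_apply, FundamentalGroup.mapOfEq_apply]
    exact congrArg (fun r => FundamentalGroup.fromPath (Path.Homotopic.Quotient.mk r))
      (Path.ext (funext fun t => h (γ t)))

-- adapted from `map_conjPath_apply` of line `zieschang-orbit-dnb-regluing` (same crux)
/-- **Naturality of the change of base point**: `π₁(e) ∘ T_ζ = T_{e ∘ ζ} ∘ π₁(e)`.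
[cite: HatcherAT2002, Prop. 1.5] -/
private theorem map_conjPath_apply' (e : C(F, Z)) {x y : F} (ζ : Path x y)
    (c : FundamentalGroup F x) :
    FundamentalGroup.map e y (FundamentalGroup.fundamentalGroupMulEquivOfPath ζ c) =
      FundamentalGroup.fundamentalGroupMulEquivOfPath (ζ.map e.continuous)
        (FundamentalGroup.map e x c) := by
  induction c using Quotient.ind with
  | _ γ =>
    change (⟦((ζ.symm.trans (γ.trans ζ)).map e.continuous)⟧ : Path.Homotopic.Quotient _ _) =
      ⟦(ζ.map e.continuous).symm.trans ((γ.map e.continuous).trans (ζ.map e.continuous))⟧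
    rw [Path.map_trans, Path.map_trans, Path.map_symm]

/-- **Kernels along a square of spaces with homeomorphisms across.**  If `i' ∘ σ = ψ ∘ i` with
`σ : F ≃ₜ F'` and `ψ : Z ≃ₜ Z'` homeomorphisms, then `σ_* : π₁(F, x) ≅ π₁(F', σ x)` carries
`ker π₁(i)` onto `ker π₁(i')`: both across maps of the induced square on `π₁` are isomorphisms
(Hatcher, *Algebraic Topology* (2002), §1.1 p. 34 and Prop. 1.18). [folklore] -/
private theorem map_ker_eq_ker_of_homeomorph_sq (i : C(F, Z)) (i' : C(F', Z')) (σ : F ≃ₜ F')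
    (ψ : Z ≃ₜ Z') (h : ∀ z, i' (σ z) = ψ (i z)) (x : F) :
    ((FundamentalGroup.map i x).ker).map (fundamentalGroupEquivOfHomeomorph σ rfl).toMonoidHom =
      (FundamentalGroup.map i' (σ x)).ker := by
  refine map_ker_eq_ker_of_sq _ _ _ (fundamentalGroupEquivOfHomeomorph ψ (h x).symm) fun a => ?_
  rw [fundamentalGroupEquivOfHomeomorph_apply, fundamentalGroupEquivOfHomeomorph_apply]
  exact map_mapOfEq_congr (σ : C(F, F')) i' i (ψ : C(Z, Z')) rfl (h x).symm h a

/-- **Kernels under change of base point.**  For a path `ζ` from `x` to `y` in `F`, the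
change-of-base-point isomorphism `T_ζ : π₁(F, x) ≅ π₁(F, y)` carries `ker π₁(i)_x` onto `ker π₁(i)_y`
(naturality of `T_ζ`, Hatcher Prop. 1.5, and `T_{i ∘ ζ}` is an isomorphism).
[cite: HatcherAT2002, Prop. 1.5] -/
private theorem map_ker_eq_ker_conjPath (i : C(F, Z)) {x y : F} (ζ : Path x y) :
    ((FundamentalGroup.map i x).ker).map
        (FundamentalGroup.fundamentalGroupMulEquivOfPath ζ).toMonoidHom =
      (FundamentalGroup.map i y).ker :=
  map_ker_eq_ker_of_sq _ _ _ (FundamentalGroup.fundamentalGroupMulEquivOfPath (ζ.map i.continuous))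
    fun a => map_conjPath_apply' i ζ a

end Helpers

/-- **Kernel pairs are natural under diffeomorphisms of triples** (stub S3 of line
`jaco-splitting-homomorphism`): a diffeomorphism of Heegaard triples
`(Φ, ψ₁, ψ₂) : (Y; H₁, H₂) ≅ (Y'; H₁', H₂')` (`Φ ∘ j₁ = j₁' ∘ ψ₁`, `Φ ∘ j₂ = j₂' ∘ ψ₂`) induces, for
any markings `μ : S_g ≅ π₁(∂H₁, x)`, `μ' : S_g ≅ π₁(∂H₁', x')` with `∂H₁'` connected, ONE
automorphism `α = μ ≫ (ψ₁|∂H₁)_* ≫ T_ζ ≫ μ'⁻¹` of `S_g` carrying BOTH kernels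
`μ⁻¹ ker π₁(incl₁)`, `μ⁻¹ ker π₁(incl₂ ∘ f)` onto `μ'⁻¹ ker π₁(incl₁')`, `μ'⁻¹ ker π₁(incl₂' ∘ f')`:
`ψ₁` restricts to `σ : ∂H₁ ≃ₜ ∂H₁'` over `incl`, the seam relations give
`incl₂' ∘ f' ∘ σ = ψ₂ ∘ incl₂ ∘ f`, kernels are natural along squares with homeomorphisms across,
and the change of base point `T_ζ` along a path `ζ : σ x ⇝ x'` is natural.  This is where the
SIMULTANEOUS `α` of the crux is born from ONE diffeomorphism of triples.
[cite: Hempel1976, proof of Thm. 14.6] [cite: HatcherAT2002, Prop. 1.5] -/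
theorem stub_kernelPairTransport :
    ∀ (g : ℕ)
      (H₁ : Type) [TopologicalSpace H₁] [ChartedSpace (EuclideanHalfSpace 3) H₁] [IsManifold (𝓡∂ 3) ∞ H₁]
      (H₂ : Type) [TopologicalSpace H₂] [ChartedSpace (EuclideanHalfSpace 3) H₂] [IsManifold (𝓡∂ 3) ∞ H₂]
      (b₁ : BoundaryData (𝓡∂ 3) H₁ (𝓡 2)) (b₂ : BoundaryData (𝓡∂ 3) H₂ (𝓡 2))
      (f : b₁.carrier ≃ₘ⟮𝓡 2, 𝓡 2⟯ b₂.carrier)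
      (Y : Type) [TopologicalSpace Y] [T2Space Y] [SecondCountableTopology Y]
      [ChartedSpace (EuclideanSpace ℝ (Fin 3)) Y] [IsManifold (𝓡 3) ∞ Y]
      (j₁ : H₁ → Y) (j₂ : H₂ → Y) (_ : IsBoundaryGluingWith b₁ b₂ f (𝓡 3) j₁ j₂)
      (x : b₁.carrier) (μ : SurfaceGroup g ≃* FundamentalGroup b₁.carrier x)
      (H₁' : Type) [TopologicalSpace H₁'] [ChartedSpace (EuclideanHalfSpace 3) H₁']
      [IsManifold (𝓡∂ 3) ∞ H₁']
      (H₂' : Type) [TopologicalSpace H₂'] [ChartedSpace (EuclideanHalfSpace 3) H₂']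
      [IsManifold (𝓡∂ 3) ∞ H₂']
      (b₁' : BoundaryData (𝓡∂ 3) H₁' (𝓡 2)) (b₂' : BoundaryData (𝓡∂ 3) H₂' (𝓡 2))
      (f' : b₁'.carrier ≃ₘ⟮𝓡 2, 𝓡 2⟯ b₂'.carrier)
      (Y' : Type) [TopologicalSpace Y'] [T2Space Y'] [SecondCountableTopology Y']
      [ChartedSpace (EuclideanSpace ℝ (Fin 3)) Y'] [IsManifold (𝓡 3) ∞ Y']
      (j₁' : H₁' → Y') (j₂' : H₂' → Y') (_ : IsBoundaryGluingWith b₁' b₂' f' (𝓡 3) j₁' j₂')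
      (_ : ConnectedSpace b₁'.carrier)
      (x' : b₁'.carrier) (μ' : SurfaceGroup g ≃* FundamentalGroup b₁'.carrier x')
      (Φ : Y ≃ₘ⟮𝓡 3, 𝓡 3⟯ Y') (ψ₁ : H₁ ≃ₘ⟮𝓡∂ 3, 𝓡∂ 3⟯ H₁') (ψ₂ : H₂ ≃ₘ⟮𝓡∂ 3, 𝓡∂ 3⟯ H₂'),
      Φ ∘ j₁ = j₁' ∘ ψ₁ → Φ ∘ j₂ = j₂' ∘ ψ₂ →
      ∃ α : SurfaceGroup g ≃* SurfaceGroup g,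
        ((FundamentalGroup.map ⟨b₁.incl, b₁.continuous_incl⟩ x).ker.comap μ.toMonoidHom).map
            α.toMonoidHom =
          (FundamentalGroup.map ⟨b₁'.incl, b₁'.continuous_incl⟩ x').ker.comap μ'.toMonoidHom ∧
        ((FundamentalGroup.map ⟨b₂.incl ∘ f, b₂.continuous_incl.comp f.continuous⟩ x).ker.comap
            μ.toMonoidHom).map α.toMonoidHom =
          (FundamentalGroup.map ⟨b₂'.incl ∘ f', b₂'.continuous_incl.comp f'.continuous⟩ x').ker.comap
            μ'.toMonoidHom := by
  intro g H₁ _ _ _ H₂ _ _ _ b₁ b₂ f Y _ _ _ _ _ j₁ j₂ hj x μ H₁' _ _ _ H₂' _ _ _ b₁' b₂' f' Y' _ _ _ _ _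
    j₁' j₂' hj' hconn x' μ' Φ ψ₁ ψ₂ hΦ₁ hΦ₂
  -- (1) `ψ₁` restricts to a homeomorphism `σ : ∂H₁ ≃ₜ ∂H₁'` over the inclusions
  have h0 : (∞ : WithTop ℕ∞) ≠ 0 := by simp
  let e₁ : b₁.carrier ≃ₜ ↥((𝓡∂ 3).boundary H₁) :=
    b₁.isSmoothEmbedding.isEmbedding.toHomeomorph.trans (Homeomorph.setCongr b₁.range_incl)
  let e₁' : b₁'.carrier ≃ₜ ↥((𝓡∂ 3).boundary H₁') :=
    b₁'.isSmoothEmbedding.isEmbedding.toHomeomorph.trans (Homeomorph.setCongr b₁'.range_incl)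
  let σ : b₁.carrier ≃ₜ b₁'.carrier := (e₁.trans (ψ₁.boundaryHomeomorph h0)).trans e₁'.symm
  have hσ : ∀ z, b₁'.incl (σ z) = ψ₁ (b₁.incl z) := fun z =>
    congrArg Subtype.val (e₁'.apply_symm_apply (ψ₁.boundaryHomeomorph h0 (e₁ z)))
  -- (2) the second square, from the two seam relations and the two intertwining identities
  have hσ₂ : ∀ z, b₂'.incl (f' (σ z)) = ψ₂ (b₂.incl (f z)) := by
    intro z
    have h1 : Φ (j₁ (b₁.incl z)) = Φ (j₂ (b₂.incl (f z))) := congrArg Φ (hj.apply_incl z)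
    have h2 : Φ (j₁ (b₁.incl z)) = j₁' (ψ₁ (b₁.incl z)) := congrFun hΦ₁ (b₁.incl z)
    have h3 : Φ (j₂ (b₂.incl (f z))) = j₂' (ψ₂ (b₂.incl (f z))) := congrFun hΦ₂ (b₂.incl (f z))
    rw [h2, h3, ← hσ] at h1
    obtain ⟨z', hz', hz''⟩ := (hj'.apply_eq_apply_iff _ _).1 h1
    obtain rfl : σ z = z' := b₁'.injective_incl hz'
    exact hz''.symm
  -- (3) `σ_*` carries both kernels at `x` onto the corresponding kernels at `σ x`
  have hK₁ := map_ker_eq_ker_of_homeomorph_sq ⟨b₁.incl, b₁.continuous_incl⟩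
    ⟨b₁'.incl, b₁'.continuous_incl⟩ σ ψ₁.toHomeomorph hσ x
  have hK₂ := map_ker_eq_ker_of_homeomorph_sq ⟨b₂.incl ∘ f, b₂.continuous_incl.comp f.continuous⟩
    ⟨b₂'.incl ∘ f', b₂'.continuous_incl.comp f'.continuous⟩ σ ψ₂.toHomeomorph hσ₂ x
  -- (4) change of base point from `σ x` to `x'` in the path-connected surface `∂H₁'`
  haveI := ChartedSpace.locallyPathConnectedSpace (EuclideanSpace ℝ (Fin 2)) b₁'.carrier
  haveI : PathConnectedSpace b₁'.carrier := pathConnectedSpace_iff_connectedSpace.mpr hconn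
  let ζ : Path (σ x) x' := PathConnectedSpace.somePath (σ x) x'
  -- (5) assemble `α = μ ≫ σ_* ≫ T_ζ ≫ μ'⁻¹`
  let Θ : FundamentalGroup b₁.carrier x ≃* FundamentalGroup b₁'.carrier x' :=
    (fundamentalGroupEquivOfHomeomorph σ rfl).trans (FundamentalGroup.fundamentalGroupMulEquivOfPath ζ)
  refine ⟨μ.trans (Θ.trans μ'.symm), ?_, ?_⟩
  · rw [map_comap_markings, map_trans_eq_map_map, hK₁, map_ker_eq_ker_conjPath]
  · rw [map_comap_markings, map_trans_eq_map_map, hK₂, map_ker_eq_ker_conjPath]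

end Summit.SmoothPoincare4.SmoothPoincare4.Theorems.WaldhausenPairs.JacoSplittingHomomorphism

end
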